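import Summits.QuantumFields.YangMills.Theses.F4SubCurvatureDoor
import Summits.QuantumFields.YangMills.Theorems.F4SubCurvatureDoorGermToGlobal
import Summits.QuantumFields.YangMills.Theorems.F4SubCurvatureDoorJointAnalyticityOffMirrorsMain
import HarnessLib

/-!
# Route `F4SubCurvatureDoor`, crux ⟨stmt-QuantumFields-23035⟩ `ShortRootRigidity` / leaf ⟨23125⟩ `RationalToGeneral`:
# LINE g16-A «GLOBAL REDUCTION» — the REDUCTION CERTIFICATE `ShortRootRigidity ↔ (global form C3)`

The route owner's kernel-checked certificate (`HOME ym-idea-3/l16/GlobalReduction-v3.lean`, planner `ym-idea-3` g16, critic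
idea-crit-4 PASS 2026-08-29T00:17Z), re-keyed to the tree theorems `F4SubCurvatureDoorGlobalReduction.germToGlobal` (C2, p679234) and
`F4SubCurvatureDoorGlobalReduction.jointAnalyticityOffMirrors` (C1): the route crux `ShortRootRigidity` (germ form: invariance of the
kernel on a punctured ball under the isometries preserving the checkerboard lattice `D₄` ⇒ invariance under every isometry on that ball)
is EQUIVALENT to its GLOBAL form C3 (`GlobalShortRootRigidity` of the owner's skeleton, SPELLED OUT here — no new definitions):
«class (continuous off `0`, bounded outside the unit ball, `W(B₄)`-invariant, reflection positive across `x₀ = 0`) + sub-curvature budget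
`‖x‖⁸ K → 0` + GLOBAL `D₄`-lattice invariance ⇒ GLOBAL `O(4)`-invariance».

* `shortRootRigidity_of_global` — C3 ⇒ `ShortRootRigidity`: joint analyticity off the mirrors (C1) + germ-to-global (C2) globalise
  the germ hypothesis, then C3 applies;
* `global_of_shortRootRigidity` — the elementary converse (`ρ := ‖x‖ + 1`);
* `shortRootRigidity_iff_global` — the certificate; `rationalToGeneral_of_global` — hence the served leaf ⟨23125⟩ from C3.

HONEST FRAMING: a REDUCTION (`--supports stmt-QuantumFields-23125`); C3 — THE WALL — is NOT proved, so neither ⟨23035⟩ nor ⟨23125⟩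
closes; no rung of LADDER-YM (`BalabanLadder.ROT`) or mass-gap statement is proved.  Width seat `ym-line-sfw-p2-w4` g19 (cell
ym-idea-1, free hands), on the owner's ASK of 2026-08-29T00:17:58Z. [folklore]
-/

set_option autoImplicit false

namespace Summit.QuantumFields.YangMills.Theorems.F4SubCurvatureDoorGlobalReduction

open scoped Topology BigOperators
open Filter Set
open Literature.MathematicalPhysics.QuantumLattice (timeReflection siteToE)
open Summit.QuantumFields.YangMills.Cruxes.OSLegsAtWeakCouplingC.Sketch (IsSignedPerm)
open Summit.QuantumFields.YangMills.Theses.F4SubCurvatureDoor (ShortRootRigidity RationalToGeneral)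

/-- **C3 ⇒ ⟨23035⟩.**  The global form of short-root rigidity (spelled out) implies the route crux `ShortRootRigidity`:
C1 (`jointAnalyticityOffMirrors`) and C2 (`germToGlobal`) turn the germ hypothesis into global `D₄`-lattice invariance. [folklore] -/
theorem shortRootRigidity_of_global
    (h3 : ∀ K : EuclideanSpace ℝ (Fin 4) → ℝ,
      ContinuousOn K {x | x ≠ 0} →
      (∃ C : ℝ, ∀ x, 1 ≤ ‖x‖ → |K x| ≤ C) →
      (∀ R : EuclideanSpace ℝ (Fin 4) ≃ₗᵢ[ℝ] EuclideanSpace ℝ (Fin 4), IsSignedPerm R → ∀ x, K (R x) = K x) →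
      (∀ (m : ℕ) (x : Fin m → EuclideanSpace ℝ (Fin 4)) (c : Fin m → ℝ), (∀ i, 0 < x i 0) →
          0 ≤ ∑ i, ∑ j, c i * c j * K (timeReflection 4 (x i) - x j)) →
      Tendsto (fun x : EuclideanSpace ℝ (Fin 4) => ‖x‖ ^ 8 * K x) (𝓝[≠] 0) (𝓝 0) →
      (∀ R : EuclideanSpace ℝ (Fin 4) ≃ₗᵢ[ℝ] EuclideanSpace ℝ (Fin 4),
          (∀ z : Fin 4 → ℤ, Even (∑ i, z i) → ∃ w : Fin 4 → ℤ, Even (∑ i, w i) ∧ R (siteToE z) = siteToE w) →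
          ∀ x, K (R x) = K x) →
      ∀ (R : EuclideanSpace ℝ (Fin 4) ≃ₗᵢ[ℝ] EuclideanSpace ℝ (Fin 4)) (x : EuclideanSpace ℝ (Fin 4)), K (R x) = K x) :
    ShortRootRigidity := by
  intro K hK hbd hB hRP hbud ρ hρ hgerm R x _hx _hxρ
  have hA : AnalyticOnNhd ℝ K {x | ∀ i, x i ≠ 0} := jointAnalyticityOffMirrors K hK hbd hB hRP
  have hglob : ∀ R' : EuclideanSpace ℝ (Fin 4) ≃ₗᵢ[ℝ] EuclideanSpace ℝ (Fin 4),
      (∀ z : Fin 4 → ℤ, Even (∑ i, z i) → ∃ w : Fin 4 → ℤ, Even (∑ i, w i) ∧ R' (siteToE z) = siteToE w) →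
      ∀ y, K (R' y) = K y := by
    intro R' hR' y
    by_cases hy : y = 0
    · subst hy; simp
    · exact germToGlobal K hK hA R' ρ hρ (hgerm R' hR') y hy
  exact h3 K hK hbd hB hRP hbud hglob R x

/-- **⟨23035⟩ ⇒ C3** (elementary: take `ρ := ‖x‖ + 1`). [folklore] -/
theorem global_of_shortRootRigidity (h : ShortRootRigidity) :
    ∀ K : EuclideanSpace ℝ (Fin 4) → ℝ,
      ContinuousOn K {x | x ≠ 0} →
      (∃ C : ℝ, ∀ x, 1 ≤ ‖x‖ → |K x| ≤ C) →
      (∀ R : EuclideanSpace ℝ (Fin 4) ≃ₗᵢ[ℝ] EuclideanSpace ℝ (Fin 4), IsSignedPerm R → ∀ x, K (R x) = K x) →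
      (∀ (m : ℕ) (x : Fin m → EuclideanSpace ℝ (Fin 4)) (c : Fin m → ℝ), (∀ i, 0 < x i 0) →
          0 ≤ ∑ i, ∑ j, c i * c j * K (timeReflection 4 (x i) - x j)) →
      Tendsto (fun x : EuclideanSpace ℝ (Fin 4) => ‖x‖ ^ 8 * K x) (𝓝[≠] 0) (𝓝 0) →
      (∀ R : EuclideanSpace ℝ (Fin 4) ≃ₗᵢ[ℝ] EuclideanSpace ℝ (Fin 4),
          (∀ z : Fin 4 → ℤ, Even (∑ i, z i) → ∃ w : Fin 4 → ℤ, Even (∑ i, w i) ∧ R (siteToE z) = siteToE w) →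
          ∀ x, K (R x) = K x) →
      ∀ (R : EuclideanSpace ℝ (Fin 4) ≃ₗᵢ[ℝ] EuclideanSpace ℝ (Fin 4)) (x : EuclideanSpace ℝ (Fin 4)), K (R x) = K x := by
  intro K hK hbd hB hRP hbud hlat R x
  by_cases hx : x = 0
  · subst hx; simp
  · exact h K hK hbd hB hRP hbud (‖x‖ + 1) (by positivity) (fun R' hR' y _ _ => hlat R' hR' y) R x hx (lt_add_one _)

/-- **REDUCTION CERTIFICATE of LINE g16-A**: the route crux ⟨23035⟩ `ShortRootRigidity` is EQUIVALENT to its global form C3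
(spelled out).  C3 is THE WALL; nothing is proved about it here. [folklore] -/
theorem shortRootRigidity_iff_global :
    ShortRootRigidity ↔
    ∀ K : EuclideanSpace ℝ (Fin 4) → ℝ,
      ContinuousOn K {x | x ≠ 0} →
      (∃ C : ℝ, ∀ x, 1 ≤ ‖x‖ → |K x| ≤ C) →
      (∀ R : EuclideanSpace ℝ (Fin 4) ≃ₗᵢ[ℝ] EuclideanSpace ℝ (Fin 4), IsSignedPerm R → ∀ x, K (R x) = K x) →
      (∀ (m : ℕ) (x : Fin m → EuclideanSpace ℝ (Fin 4)) (c : Fin m → ℝ), (∀ i, 0 < x i 0) →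
          0 ≤ ∑ i, ∑ j, c i * c j * K (timeReflection 4 (x i) - x j)) →
      Tendsto (fun x : EuclideanSpace ℝ (Fin 4) => ‖x‖ ^ 8 * K x) (𝓝[≠] 0) (𝓝 0) →
      (∀ R : EuclideanSpace ℝ (Fin 4) ≃ₗᵢ[ℝ] EuclideanSpace ℝ (Fin 4),
          (∀ z : Fin 4 → ℤ, Even (∑ i, z i) → ∃ w : Fin 4 → ℤ, Even (∑ i, w i) ∧ R (siteToE z) = siteToE w) →
          ∀ x, K (R x) = K x) →
      ∀ (R : EuclideanSpace ℝ (Fin 4) ≃ₗᵢ[ℝ] EuclideanSpace ℝ (Fin 4)) (x : EuclideanSpace ℝ (Fin 4)), K (R x) = K x :=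
  ⟨global_of_shortRootRigidity, shortRootRigidity_of_global⟩

/-- … hence the served leaf ⟨23125⟩ `RationalToGeneral` from C3 alone (conditional). [folklore] -/
theorem rationalToGeneral_of_global
    (h3 : ∀ K : EuclideanSpace ℝ (Fin 4) → ℝ,
      ContinuousOn K {x | x ≠ 0} →
      (∃ C : ℝ, ∀ x, 1 ≤ ‖x‖ → |K x| ≤ C) →
      (∀ R : EuclideanSpace ℝ (Fin 4) ≃ₗᵢ[ℝ] EuclideanSpace ℝ (Fin 4), IsSignedPerm R → ∀ x, K (R x) = K x) →
      (∀ (m : ℕ) (x : Fin m → EuclideanSpace ℝ (Fin 4)) (c : Fin m → ℝ), (∀ i, 0 < x i 0) →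
          0 ≤ ∑ i, ∑ j, c i * c j * K (timeReflection 4 (x i) - x j)) →
      Tendsto (fun x : EuclideanSpace ℝ (Fin 4) => ‖x‖ ^ 8 * K x) (𝓝[≠] 0) (𝓝 0) →
      (∀ R : EuclideanSpace ℝ (Fin 4) ≃ₗᵢ[ℝ] EuclideanSpace ℝ (Fin 4),
          (∀ z : Fin 4 → ℤ, Even (∑ i, z i) → ∃ w : Fin 4 → ℤ, Even (∑ i, w i) ∧ R (siteToE z) = siteToE w) →
          ∀ x, K (R x) = K x) →
      ∀ (R : EuclideanSpace ℝ (Fin 4) ≃ₗᵢ[ℝ] EuclideanSpace ℝ (Fin 4)) (x : EuclideanSpace ℝ (Fin 4)), K (R x) = K x) :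
    RationalToGeneral :=
  fun _ => shortRootRigidity_of_global h3

end Summit.QuantumFields.YangMills.Theorems.F4SubCurvatureDoorGlobalReduction
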